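import Mathlib.Topology.Algebra.Group.Quotient
import Mathlib.Topology.Algebra.Constructions
import Mathlib.Algebra.GroupWithZero.Action.End
import Summits.ABC.IUTFork.LanaGMData
import Summits.ABC.IUTFork.LanaLocalUnits
import HarnessLib

/-!
# L-LANA objects III: the reference local data as GM-data, Table 1, prime-strips (LANA §3.7–3.10)

Record-only file (D-0012) of the abc-iut cell (seat abc-iut-c312-4, L-LANA level, plan/LLANA-SPEC N5 and
the topological half of N3/N4); TAKES NO SIDE on [IUTchIII] Cor. 3.12. It packages the algebra of
`LanaLocalUnits.lean` (`O^▷ ⊇ O^× ↠ O^{×μ}`, `I^κ_H`) with its topologies (subspace of `K̄_v^×`, quotient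
topology) and continuous actions into the GM-data of `LanaGMData.lean`, giving — as CONSTRUCTIONS from one
input package per place (`RefLocalDatum`: the valued field `K̄_v` with `G_v` acting, and a topological group
`Π_v` with a continuous surjection `Π_v ↠ G_v`) — the five local data of Project LANA's Table 1
(bib `LANA2026Report`, read on the page):

* §3.10 p. 22 / Table 1: "the local data `G_v`, `G_v ↷ O^×_v`, `(G_v ↷ O^{×μ}_v, {I^κ_H}_H)` are denoted by
  the symbols `D^⊢_v`, `F^{⊢×}_v`, `F^{⊢×μ}_v` respectively. Here, the superscript "⊢" denotes "mono-analytic".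
  Also, the local data `Π_v`, `Π_v ↷ O^▷_v` are denoted by the symbols `D_v`, `F_v` respectively. Here,
  `Π_v ↷ O^▷_v` is the action determined by the natural surjection `Π_v ↠ G_v`" — `RefLocalDatum.Dmono`,
  `.Funit`, `.FunitMu` (a `GMDataK`: compact structure = `I^κ_H` over OPEN `H`), `.D`, `.Fhol`.
* §3.7 p. 20: "In IUT theory, one often considers abstract GM-data that are isomorphic to the GM-data
  `Π_v ↷ O^▷_v` or `G_v ↷ O^{×μ}_v`. … let us call the former holomorphic GM-data and the latter mono-analytic
  GM-data." — `GMData.IsHolomorphic`, `GMData.IsMonoAnalytic` (§0.4 (e): "is isomorphic to" = ∃ iso).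
* §3.10 p. 23: "An object abstractly isomorphic to the collection of these local data, i.e.,
  `{D^⊢_v}_{v∈V}` (resp. `{F^{⊢×}_v}_{v∈V}`, `{F^{⊢×μ}_v}_{v∈V}`, `{D_v}_{v∈V}`, `{F_v}_{v∈V}`) is called a
  `D^⊢`-prime-strip (resp. `F^{⊢×}`-prime-strip, `F^{⊢×μ}`-prime-strip, `D`-prime-strip, `F`-prime-strip)."
  — `DMonoPrimeStrip := EtaleBPS` and `FUnitMuPrimeStrip := EtaleUnitBPS` (Def. 4.1.1/4.1.2 say so),
  `GMFamily` (copies of a reference family of GM-data: `FUnitPrimeStrip`, `FPrimeStrip`),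
  `DPrimeStrip`; each with its isomorphisms and "any two are isomorphic" PROVED.

Modelling notes. (i) Rem. 3.10.1 p. 22: in IUT "`D^⊢_v` is not the profinite group `G_v` itself. Rather, it
is the full subcategory consisting of connected objects of the Galois category determined by this profinite
group … `G_v` and `D^⊢_v` are "roughly equivalent data." Similarly … `F^{⊢×}_v` is … a certain Frobenioid
whose data are equivalent to this GM-data" — this file follows LANA's group-level substitute; the
Galois-category / Frobenioid versions are layers L1/L3 of the campaign. (ii) §3.8 (a) p. 20: "`Π_v` denotes
… the tempered fundamental group `π₁^{temp}(X_v)` [bad `v`] … the étale fundamental group `π₁^{ét}` [good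
`v`] … there exists a natural surjective homomorphism `Π_v ↠ G_v`": here `Π_v` and the surjection are INPUT
data (`RefLocalDatum.P`, `.ρ`) — TODO-merge: abc-iut-L3-t2 (tempered `π₁`), abc-iut-L4-t1 (`G_v`,
`1 → Δ → Π → G → 1`). (iii) Archimedean places ("infinite-place versions", p. 23) are not modelled.
NOT here: the Θ-link and (Ind1)/(Ind2) (sibling `LanaThetaLink.lean`), log-shells, any judgement.
-/

noncomputable section

namespace Summit.ABC
namespace IUTFork

open Topology

/-! ## 1. The input package at one place and its topologised unit data -/

/-- INPUT at a nonarchimedean place `v` (interface; modelling note (ii)): the field `K̄_v` with its topology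
and valuation `| · |`, the topological group `G_v` acting continuously by valuation-preserving ring
automorphisms (§3.5 p. 19), and a topological group `Π_v` with a continuous surjection `Π_v ↠ G_v` (§3.8 (a)
pp. 20–21 "there exists a natural surjective homomorphism `Π_v ↠ G_v`").
[cite: LANA2026Report, §3.8 (a) pp. 20–21] -/
structure RefLocalDatum : Type 1 where
  /-- `K̄_v` -/
  K : Type
  [instField : Field K]
  [instTopK : TopologicalSpace K]
  [instContinuousMul : ContinuousMul K]
  /-- the value group (with zero) of `| · |` -/
  Γ₀ : Type
  [instΓ₀ : LinearOrderedCommGroupWithZero Γ₀]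
  /-- `| · |` -/
  w : Valuation K Γ₀
  /-- `G_v` -/
  G : Type
  [instGroup : Group G]
  [instTopG : TopologicalSpace G]
  [instIsTopGroup : IsTopologicalGroup G]
  [instAction : MulSemiringAction G K]
  [instVal : IsValPreserving w G]
  [instContinuousSMul : ContinuousSMul G K]
  /-- `Π_v` -/
  P : Type
  [instGroupP : Group P]
  [instTopP : TopologicalSpace P]
  [instIsTopGroupP : IsTopologicalGroup P]
  /-- `Π_v ↠ G_v` -/
  ρ : P →ₜ* G
  /-- surjectivity of `Π_v ↠ G_v` -/
  ρ_surjective : Function.Surjective ρ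

/-- `K̄_v` is a field. [cite: LANA2026Report, §3.8 (a) p. 20] -/
instance (L : RefLocalDatum) : Field L.K := L.instField
/-- topology of `K̄_v`. [cite: LANA2026Report, §3.8 (a) p. 20] -/
instance (L : RefLocalDatum) : TopologicalSpace L.K := L.instTopK
/-- `K̄_v` is a topological monoid under multiplication. [cite: LANA2026Report, §3.8 (a) p. 20] -/
instance (L : RefLocalDatum) : ContinuousMul L.K := L.instContinuousMul
/-- the value group. [cite: LANA2026Report, §0.4 (b) p. 8] -/
instance (L : RefLocalDatum) : LinearOrderedCommGroupWithZero L.Γ₀ := L.instΓ₀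
/-- `G_v` is a group. [cite: LANA2026Report, §3.5 p. 19] -/
instance (L : RefLocalDatum) : Group L.G := L.instGroup
/-- topology of `G_v`. [cite: LANA2026Report, §3.5 p. 19] -/
instance (L : RefLocalDatum) : TopologicalSpace L.G := L.instTopG
/-- `G_v` is a topological group. [cite: LANA2026Report, §3.5 p. 19] -/
instance (L : RefLocalDatum) : IsTopologicalGroup L.G := L.instIsTopGroup
/-- `G_v ↷ K̄_v` by ring automorphisms. [cite: LANA2026Report, §3.5 p. 19] -/
instance (L : RefLocalDatum) : MulSemiringAction L.G L.K := L.instAction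
/-- `G_v` preserves `| · |`. [cite: LANA2026Report, §3.5 p. 19] -/
instance (L : RefLocalDatum) : IsValPreserving L.w L.G := L.instVal
/-- `G_v ↷ K̄_v` is continuous. [cite: LANA2026Report, Def. 3.7.1 p. 20] -/
instance (L : RefLocalDatum) : ContinuousSMul L.G L.K := L.instContinuousSMul
/-- `Π_v` is a group. [cite: LANA2026Report, §3.8 (a) p. 20] -/
instance (L : RefLocalDatum) : Group L.P := L.instGroupP
/-- topology of `Π_v`. [cite: LANA2026Report, §3.8 (a) p. 20] -/
instance (L : RefLocalDatum) : TopologicalSpace L.P := L.instTopP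
/-- `Π_v` is a topological group. [cite: LANA2026Report, §3.8 (a) p. 20] -/
instance (L : RefLocalDatum) : IsTopologicalGroup L.P := L.instIsTopGroupP

namespace RefLocalDatum

variable (L : RefLocalDatum)

/-- `G_v ↷ O^×_v` is continuous (subspace topology of `K̄_v^×`). [cite: LANA2026Report, §3.6 p. 19] -/
instance continuousSMul_unitGrp : ContinuousSMul L.G (unitGrp L.w) := by
  refine ⟨continuous_induced_rng.2 (Units.continuous_iff.2 ⟨?_, ?_⟩)⟩
  · change Continuous fun p : L.G × unitGrp L.w => p.1 • (((p.2 : L.Kˣ)) : L.K)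
    fun_prop
  · change Continuous fun p : L.G × unitGrp L.w => p.1 • (((p.2 : L.Kˣ)⁻¹ : L.Kˣ) : L.K)
    fun_prop

/-- `G_v ↷ O^{×μ}_v` is continuous (quotient topology). [cite: LANA2026Report, §3.6 p. 20] -/
instance continuousSMul_unitsModTorsion : ContinuousSMul L.G (UnitsModTorsion L.w) := by
  refine ⟨?_⟩
  have hq : IsOpenQuotientMap
      (Prod.map id (QuotientGroup.mk : unitGrp L.w → UnitsModTorsion L.w) :
        L.G × unitGrp L.w → L.G × UnitsModTorsion L.w) :=
    IsOpenQuotientMap.id.prodMap QuotientGroup.isOpenQuotientMap_mk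
  rw [← hq.continuous_comp_iff]
  change Continuous fun p : L.G × unitGrp L.w => ((p.1 • p.2 : unitGrp L.w) : UnitsModTorsion L.w)
  exact QuotientGroup.continuous_mk.comp continuous_smul

/-- `G_v ↷ O^▷_v` is continuous (subspace topology of `K̄_v`). [cite: LANA2026Report, §3.7 p. 20] -/
instance continuousSMul_intMonoid : ContinuousSMul L.G (intMonoid L.w) := by
  refine ⟨continuous_induced_rng.2 ?_⟩
  change Continuous fun p : L.G × intMonoid L.w => p.1 • (p.2 : L.K)
  fun_prop

/-! ## 2. Table 1 (§3.10 p. 22): the five local data, constructed -/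

/-- **Table 1: `D^⊢_v` = `G_v`** (modelling note (i)). [cite: LANA2026Report, §3.10 Table 1 p. 22] -/
abbrev Dmono : Type := L.G

/-- **Table 1: `F^{⊢×}_v` = `G_v ↷ O^×_v`**, as GM-data. [cite: LANA2026Report, §3.10 Table 1 p. 22] -/
def Funit : GMData where
  G := L.G
  M := unitGrp L.w

/-- **Table 1: `F^{⊢×μ}_v` = `(G_v ↷ O^{×μ}_v, {I^κ_H}_H)`**, as GM-data WITH COMPACT STRUCTURE (Def. 3.9.1:
`I^κ_H` for OPEN subgroups `H < G_v`). This is the reference étale-unit datum at `v` of Def. 4.1.2.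
[cite: LANA2026Report, §3.10 Table 1 p. 22, Def. 3.9.1 p. 22] -/
def FunitMu : GMDataK where
  G := L.G
  M := UnitsModTorsion L.w
  N H := (kummerStructure L.w L.G (H : Subgroup L.G)).toSubmonoid

/-- The compact structure of `F^{⊢×μ}_v` at `H` is `I^κ_H`. [cite: LANA2026Report, Def. 3.9.1 p. 22] -/
theorem FunitMu_N (H : OpenSubgroup L.G) :
    L.FunitMu.N H = (kummerStructure L.w L.G (H : Subgroup L.G)).toSubmonoid := rfl

/-- **Table 1: `D_v` = `Π_v`**. [cite: LANA2026Report, §3.10 Table 1 p. 22] -/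
abbrev D : Type := L.P

/-- `Π_v ↷ O^▷_v`, "the action determined by the natural surjection `Π_v ↠ G_v`" (pull-back along `ρ`).
[cite: LANA2026Report, §3.10 p. 22] -/
abbrev holAction : MulDistribMulAction L.P (intMonoid L.w) :=
  MulDistribMulAction.compHom (intMonoid L.w) (L.ρ : L.P →* L.G)

/-- The pulled-back action is continuous. [cite: LANA2026Report, §3.10 p. 22] -/
theorem continuousSMul_holAction :
    @ContinuousSMul L.P (intMonoid L.w) L.holAction.toSMul _ _ := by
  letI := L.holAction
  refine ⟨?_⟩
  change Continuous fun p : L.P × intMonoid L.w => (L.ρ p.1 • p.2 : intMonoid L.w)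
  exact continuous_smul.comp ((map_continuous L.ρ).prodMap continuous_id)

/-- **Table 1: `F_v` = `Π_v ↷ O^▷_v`** (via `Π_v ↠ G_v`), as GM-data.
[cite: LANA2026Report, §3.10 Table 1 p. 22] -/
def Fhol : GMData :=
  letI := L.holAction
  haveI := L.continuousSMul_holAction
  { G := L.P, M := intMonoid L.w }

/-- In `F_v` the element `p ∈ Π_v` acts through its image in `G_v`. [cite: LANA2026Report, §3.10 p. 22] -/
theorem Fhol_smul (p : L.P) (a : intMonoid L.w) :
    (@HSMul.hSMul L.Fhol.G L.Fhol.M L.Fhol.M (@instHSMul _ _ L.Fhol.instAction.toSMul) p a : intMonoid L.w) =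
      L.ρ p • a := rfl

end RefLocalDatum

/-! ## 3. Holomorphic and mono-analytic GM-data (§3.7) -/

/-- **§3.7 p. 20**: "abstract GM-data that are isomorphic to the GM-data `Π_v ↷ O^▷_v` … let us call …
holomorphic GM-data" ("isomorphic to" per §0.4 (e)). [cite: LANA2026Report, §3.7 p. 20] -/
@[mk_iff] structure GMData.IsHolomorphic (L : RefLocalDatum) (X : GMData) : Prop where
  /-- a copy of `F_v` -/
  isCopy : X.IsIsomorphicTo L.Fhol

/-- **§3.7 p. 20**: "… or `G_v ↷ O^{×μ}_v` … the latter mono-analytic GM-data. These terms are used only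
provisionally in this manuscript." [cite: LANA2026Report, §3.7 p. 20] -/
@[mk_iff] structure GMData.IsMonoAnalytic (L : RefLocalDatum) (X : GMData) : Prop where
  /-- a copy of `G_v ↷ O^{×μ}_v` -/
  isCopy : X.IsIsomorphicTo L.FunitMu.toGMData

/-- The reference data are holomorphic, resp. mono-analytic. [cite: LANA2026Report, §3.7 p. 20] -/
theorem RefLocalDatum.isHolomorphic_Fhol (L : RefLocalDatum) : GMData.IsHolomorphic L L.Fhol :=
  ⟨GMData.IsIsomorphicTo.refl _⟩

/-- The reference mono-analytic datum is mono-analytic. [cite: LANA2026Report, §3.7 p. 20] -/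
theorem RefLocalDatum.isMonoAnalytic_FunitMu (L : RefLocalDatum) :
    GMData.IsMonoAnalytic L L.FunitMu.toGMData :=
  ⟨GMData.IsIsomorphicTo.refl _⟩

/-- Def. 3.9.1 (a): GM-data with compact structure that is a copy of `F^{⊢×μ}_v` has mono-analytic
underlying GM-data. [cite: LANA2026Report, Def. 3.9.1 (a) p. 22] -/
theorem GMDataK.IsCopyOf.isMonoAnalytic {L : RefLocalDatum} {X : GMDataK} (h : L.FunitMu.IsCopyOf X) :
    GMData.IsMonoAnalytic L X.toGMData :=
  ⟨h.nonempty.elim fun φ => ⟨⟨φ.toIso⟩⟩⟩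

/-! ## 4. Prime-strips (§3.10 p. 23) over a family of places `V` -/

section Strips

variable {V : Type} (ref : V → RefLocalDatum)

/-- The reference étale-unit family `{F^{⊢×μ}_v}_{v∈V}` feeding Def. 4.1.1/4.1.2 (`LanaGMData`).
[cite: LANA2026Report, §3.10 p. 23] -/
def refUnitMu : V → GMDataK := fun v => (ref v).FunitMu

/-- **`D^⊢`-prime-strip** = étale BPS (Def. 4.1.1 (1): "An étale BPS is a `D^⊢`-prime strip").
[cite: LANA2026Report, §3.10 p. 23, Def. 4.1.1 p. 23] -/
abbrev DMonoPrimeStrip : Type 1 := EtaleBPS (refUnitMu ref)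

/-- **`F^{⊢×μ}`-prime-strip** = étale-unit BPS (Def. 4.1.2 (1): "An étale-unit BPS is an
`F^{⊢×μ}`-prime strip"). [cite: LANA2026Report, §3.10 p. 23, Def. 4.1.2 p. 23] -/
abbrev FUnitMuPrimeStrip : Type 1 := EtaleUnitBPS (refUnitMu ref)

/-- A `V`-indexed family of GM-data "abstractly isomorphic to" a reference family `R` (§0.4 (e)) — the
common shape of the `F^{⊢×}`- and `F`-prime-strips. [cite: LANA2026Report, §3.10 p. 23] -/
structure GMFamily (R : V → GMData) : Type 1 where
  /-- the local GM-data -/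
  X : V → GMData
  /-- each a copy of the reference -/
  isCopy : ∀ v, (X v).IsIsomorphicTo (R v)

namespace GMFamily

variable {R : V → GMData} (F F' : GMFamily R)

/-- Isomorphisms of such families: placewise isomorphisms of GM-data. [cite: LANA2026Report, §3.10 p. 23] -/
def Iso : Type := ∀ v, GMData.Iso (F.X v) (F'.X v)

/-- The reference family itself. [cite: LANA2026Report, §3.10 p. 23] -/
def std (R : V → GMData) : GMFamily R := ⟨R, fun v => GMData.IsIsomorphicTo.refl (R v)⟩

/-- Any two copies of the reference family are isomorphic. [cite: LANA2026Report, §3.10 p. 23] -/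
theorem iso_nonempty : Nonempty (F.Iso F') :=
  ⟨fun v => Classical.choice
    (((F.isCopy v).trans (F'.isCopy v).symm).nonempty)⟩

end GMFamily

/-- **`F^{⊢×}`-prime-strip**: a family abstractly isomorphic to `{F^{⊢×}_v}_{v∈V} = {G_v ↷ O^×_v}`.
[cite: LANA2026Report, §3.10 p. 23] -/
abbrev FUnitPrimeStrip : Type 1 := GMFamily (fun v => (ref v).Funit)

/-- **`F`-prime-strip**: a family abstractly isomorphic to `{F_v}_{v∈V} = {Π_v ↷ O^▷_v}` (holomorphic
GM-data at each place). [cite: LANA2026Report, §3.10 p. 23] -/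
abbrev FPrimeStrip : Type 1 := GMFamily (fun v => (ref v).Fhol)

/-- Each member of an `F`-prime-strip is holomorphic GM-data. [cite: LANA2026Report, §3.7 p. 20] -/
theorem FPrimeStrip.isHolomorphic {ref : V → RefLocalDatum} (F : FPrimeStrip ref) (v : V) :
    GMData.IsHolomorphic (ref v) (F.X v) :=
  ⟨F.isCopy v⟩

/-- **`D`-prime-strip**: a family of topological groups abstractly isomorphic to `{D_v}_{v∈V} = {Π_v}`.
[cite: LANA2026Report, §3.10 p. 23] -/
structure DPrimeStrip : Type 1 where
  /-- the groups `Π_v` (copies) -/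
  P : V → Type
  [instGroup : ∀ v, Group (P v)]
  [instTop : ∀ v, TopologicalSpace (P v)]
  [instIsTopGroup : ∀ v, IsTopologicalGroup (P v)]
  /-- each a copy of `Π_v` -/
  isCopy : ∀ v, Nonempty (P v ≃ₜ* (ref v).P)

/-- each `Π_v` of a `D`-prime-strip is a group, [cite: LANA2026Report, §3.10 p. 23] -/
instance {ref : V → RefLocalDatum} (D : DPrimeStrip ref) (v : V) : Group (D.P v) := D.instGroup v
/-- … a topological space, [cite: LANA2026Report, §3.10 p. 23] -/
instance {ref : V → RefLocalDatum} (D : DPrimeStrip ref) (v : V) : TopologicalSpace (D.P v) := D.instTop v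
/-- … a topological group. [cite: LANA2026Report, §3.10 p. 23] -/
instance {ref : V → RefLocalDatum} (D : DPrimeStrip ref) (v : V) : IsTopologicalGroup (D.P v) :=
  D.instIsTopGroup v

/-- Isomorphisms of `D`-prime-strips: placewise isomorphisms of topological groups.
[cite: LANA2026Report, §3.10 p. 23] -/
def DPrimeStrip.Iso {ref : V → RefLocalDatum} (D D' : DPrimeStrip ref) : Type := ∀ v, D.P v ≃ₜ* D'.P v

/-- Any two `D`-prime-strips are isomorphic. [cite: LANA2026Report, §3.10 p. 23] -/
theorem DPrimeStrip.iso_nonempty {ref : V → RefLocalDatum} (D D' : DPrimeStrip ref) :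
    Nonempty (D.Iso D') :=
  ⟨fun v => (D.isCopy v).some.trans (D'.isCopy v).some.symm⟩

/-- The `D`-prime-strip underlying an `F`-prime-strip (étale-like portions `Π_v`).
[cite: LANA2026Report, §3.10 p. 23] -/
def FPrimeStrip.toD {ref : V → RefLocalDatum} (F : FPrimeStrip ref) : DPrimeStrip ref where
  P v := (F.X v).G
  isCopy v := (F.isCopy v).nonempty.elim fun φ => ⟨φ.eG⟩

/-- The `D^⊢`-prime-strip underlying a `D`-prime-strip requires the quotient `Π_v ↠ G_v` to be
RECONSTRUCTED from the abstract group `Π_v` ("constructed group-theoretically from `Π_v`", §3.10 p. 22) —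
an anabelian input (LLANA-SPEC N9; seat abc-iut-L4-t1), typed here as the datum it must deliver: a normal
subgroup of each `Π_v` whose quotient is a copy of `G_v`. [cite: LANA2026Report, §3.10 p. 22] -/
structure DPrimeStrip.MonoAnalyticisation {ref : V → RefLocalDatum} (D : DPrimeStrip ref) : Type 1 where
  /-- the reconstructed kernels `Δ_v ⊴ Π_v` -/
  Δ : ∀ v, Subgroup (D.P v)
  [normal : ∀ v, (Δ v).Normal]
  /-- the quotient is a copy of `G_v` -/
  isCopy : ∀ v, Nonempty ((D.P v ⧸ Δ v) ≃ₜ* (ref v).G)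

end Strips

end IUTFork

end Summit.ABC

end
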